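import Summits.HubbardSuperconductivity.HubbardSuperconductivity.Theorems.AnisotropyChordTransferFibre3PhiHatClosed
import Summits.HubbardSuperconductivity.HubbardSuperconductivity.Theorems.AnisotropyChordTransferFibre3MuClosed
import Summits.HubbardSuperconductivity.HubbardSuperconductivity.Theorems.AnisotropyChordTransferFibre3N1RowNamed

/-!
# Route `AnisotropyChord` / H0 rotor rung: FIN small-`L` EXACT-BLOCK kit — every momentum is a block momentum

For `9 ≤ L ≤ 15` the row-`N₁` Level-2 program (`…N1RowExpr*`, block `|q|∞ ≤ M₂`, outer majorants, `4(M₂+2) ≤ L`) does not apply;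
instead the FIN certificate treats EVERY momentum as a block momentum: `F₂(k) = c(k) + t(k)` with `t(k)` EXACT from the
two-propagator sum `T(k) = Σ_p g(p) g(p − k)`, and `φ̂_e(k)` in the disc of centre `m_e(k) = μ_e(k) + ½(1 − e^{−ik·e}) t(k)` and
radius `τ̄/2`.  THIS FILE is the analytic kit for that evaluator (no kernel data):
* `phase_im` (`Im e^{iK·r} = sin`), ★ `tfun_eq_conv` — `t(q) = (c_s²·Σ_p g(p)g(p − q) − 2a c_s g(q))/V` for EVERY `q ≠ 0`
  (the convolution of `ŝ = −a·δ₀ + c_s g`; the general form of p2's `TfunNamed`);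
* `mC` (the disc centre), ★ `phiHat_near_mC` — `‖φ̂_e(k) − m_e(k)‖ ≤ τ̄/2` (`k ≠ 0`, `e` a nearest neighbour; from
  `PhiHatClosedPlusTail` + `TauTailBoundC` + `GradSNormClosed`), `phiHat_zero_eq` (`φ̂_e(0) = γ`);
* `mC_re`, `mC_im` — the centre in terms of `cos / sin (k·e)`: `Re m = (1 − cos)(t/2 − β) + (q/2)(1 + cos)`,
  `Im m = sin·(t/2 − β − q/2)`;
* `normSq_bracket` — `‖x − m‖ ≤ r ⇒ max(‖m‖ − r, 0)² ≤ |x|² ≤ (‖m‖ + r)²` (the cross term is p2's `blockCrossTerm_holds`;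
  `‖m‖² = re² + im²` is `Literature.Probability.Process.norm_sq_eq_re_sq_add_im_sq` / `Complex.normSq_apply`).
Prover seat `hubbard-h0-rotor-p3` g5; helper for piece A = stmt-HubbardSuperconductivity-23918 of rung 19089 (`--supports`, helper
class).  WHAT THIS IS NOT: nothing here proves superconductivity in the Hubbard model (rotor TARGET as worded stays FALSE, g15 verdict);
lemmas for the FIN certificates of ONE conditional reduction.  Tree imports only; no sorry, no new axioms.
-/

set_option linter.dupNamespace false
set_option autoImplicit false

noncomputable section

namespace Summit.HubbardSuperconductivity.HubbardSuperconductivity.Theorems.AnisotropyChord.Transfer.Fibre3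

namespace FinXB

open scoped BigOperators
open Finset

variable (L : ℕ) [NeZero L]

/-! ## The imaginary part of the fibre character -/

omit [NeZero L] in
/-- `Im e^{iK·r} = sin(2π(K₁r₁ + K₂r₂)/L)` (values read through `val`). [folklore] -/
theorem phase_im (k r : Tor L) :
    (phase L k r).im = Real.sin (2 * Real.pi * ((k.1.val * r.1.val + k.2.val * r.2.val : ℕ) : ℝ) / L) := by
  unfold phase
  rw [← Complex.exp_ofReal_mul_I_im]
  congr 1
  push_cast
  ring

/-! ## `t(q)` for every `q ≠ 0` -/

/-- ★ `t(q) = (c_s²·Σ_p g(p)g(p − q) − 2a c_s g(q))/V` for every `q ≠ 0` (`a = Δ f(x̂)`), for the ground profile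
(`L ≥ 5`, `0 ≤ Δ`). [folklore] -/
theorem tfun_eq_conv (hL : 5 ≤ L) {Δ lam2 : ℝ} (hΔ0 : 0 ≤ Δ) {f : Tor L → ℝ} (hf : IsGroundTwoMagnon L Δ lam2 f)
    {q : Tor L} (hq : q ≠ 0) :
    tfun L Δ f q
      = (cS L Δ lam2 f ^ 2 * (∑ p : Tor L, gres L lam2 p * gres L lam2 (p - q))
          - 2 * (Δ * f (K1 L)) * cS L Δ lam2 f * gres L lam2 q) / (L : ℝ) ^ 2 := by
  classical
  have hL3 : 3 ≤ L := by omega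
  have hl2 := lam2_lt_two_eps1 L hL hΔ0 hf
  set shat : Tor L → ℝ := fun q => if q = 0 then -(Δ * f (K1 L)) else cS L Δ lam2 f * gres L lam2 q with hshat
  have hdft : ∀ q : Tor L, dft L (sfun' L Δ f) q = ((shat q : ℝ) : ℂ) := by
    intro q
    rw [dft_sfun' L hL3 hf.1 hl2 q]
    simp only [hshat]
    unfold gres
    split_ifs <;> push_cast <;> ring
  have ht : tfun L Δ f q = (∑ p : Tor L, shat p * shat (q - p)) / (L : ℝ) ^ 2 := by
    unfold tfun
    rw [fsqFourier_holds L (sfun' L Δ f) q]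
    simp only [hdft]
    have : (∑ p : Tor L, ((shat p : ℝ) : ℂ) * ((shat (q - p) : ℝ) : ℂ)) / ((L : ℂ) ^ 2)
        = ((((∑ p : Tor L, shat p * shat (q - p)) / (L : ℝ) ^ 2 : ℝ)) : ℂ) := by
      push_cast; rfl
    rw [this, Complex.ofReal_re]
  have hg0 : gres L lam2 0 = 0 := by unfold gres; simp
  have hs : ∀ p : Tor L, shat p = (if p = 0 then -(Δ * f (K1 L)) else 0) + cS L Δ lam2 f * gres L lam2 p := by
    intro p
    simp only [hshat]
    split_ifs with h
    · rw [h, hg0]; ring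
    · ring
  have hconv : ∑ p : Tor L, shat p * shat (q - p)
      = cS L Δ lam2 f ^ 2 * (∑ p : Tor L, gres L lam2 p * gres L lam2 (p - q))
        - 2 * (Δ * f (K1 L)) * cS L Δ lam2 f * gres L lam2 q := by
    have e : ∀ p : Tor L, shat p * shat (q - p)
        = cS L Δ lam2 f ^ 2 * (gres L lam2 p * gres L lam2 (q - p))
          + (if p = 0 then -(Δ * f (K1 L)) * (cS L Δ lam2 f * gres L lam2 q) else 0)
          + (if p = q then -(Δ * f (K1 L)) * (cS L Δ lam2 f * gres L lam2 q) else 0) := by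
      intro p
      rw [hs p, hs (q - p)]
      by_cases h0 : p = 0
      · subst h0
        have hq0 : ¬ (q - 0 : Tor L) = 0 := by simpa using hq
        rw [if_pos rfl, if_neg hq0, if_pos rfl, if_neg (Ne.symm hq), hg0, sub_zero]; ring
      · by_cases hpq : p = q
        · subst hpq
          rw [if_neg h0, sub_self, if_pos rfl, if_neg h0, if_pos rfl, hg0]; ring
        · have : ¬ (q - p = 0) := fun h => hpq (by rw [sub_eq_zero] at h; exact h.symm)
          rw [if_neg h0, if_neg this, if_neg h0, if_neg hpq]; ring
    rw [Finset.sum_congr rfl fun p _ => e p, Finset.sum_add_distrib, Finset.sum_add_distrib,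
      Finset.sum_ite_eq' Finset.univ (0 : Tor L), Finset.sum_ite_eq' Finset.univ q, ← Finset.mul_sum]
    simp only [Finset.mem_univ, if_true]
    have hev : ∑ p : Tor L, gres L lam2 p * gres L lam2 (q - p) = ∑ p : Tor L, gres L lam2 p * gres L lam2 (p - q) := by
      refine Finset.sum_congr rfl fun p _ => ?_
      rw [← B1.gres_neg L lam2 (q - p), neg_sub]
    rw [hev]; ring
  rw [ht, hconv]

/-! ## The disc of `φ̂_e(k)` -/

/-- the disc centre `m_e(k) := μ_e(k) + ½(1 − e^{−ik·e})·t(k)`. -/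
def mC (Δ lam2 : ℝ) (f : Tor L → ℝ) (e k : Tor L) : ℂ :=
  muK L Δ lam2 f e k + (1 / 2 : ℂ) * (1 - zPh L k e) * ((tfun L Δ f k : ℝ) : ℂ)

/-- ★ `‖φ̂_e(k) − m_e(k)‖ ≤ τ̄/2` for `k ≠ 0`, `e` a nearest neighbour, ground profile (`L ≥ 5`, `0 ≤ Δ`). [folklore] -/
theorem phiHat_near_mC (hL : 5 ≤ L) {Δ lam2 : ℝ} (hΔ0 : 0 ≤ Δ) {f : Tor L → ℝ} (hf : IsGroundTwoMagnon L Δ lam2 f)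
    (hlam : 0 < lam2) {e : Tor L} (he : e ∈ nnList L) {k : Tor L} (hk : k ≠ 0) :
    ‖phiHat L f e k - mC L Δ lam2 f e k‖ ≤ tauBar L Δ lam2 f / 2 := by
  obtain ⟨-, hk'⟩ := OuterMaj.phiHatClosedPlusTail_holds L hL hΔ0 lam2 f hf hlam e he
  rw [hk' k hk]
  unfold mC
  have e1 : muK L Δ lam2 f e k + (1 / 2 : ℂ) * (1 - zPh L k e) * ((tfun L Δ f k : ℝ) : ℂ)
        + (1 / 2 : ℂ) * tauC L Δ f e k
        - (muK L Δ lam2 f e k + (1 / 2 : ℂ) * (1 - zPh L k e) * ((tfun L Δ f k : ℝ) : ℂ))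
      = (1 / 2 : ℂ) * tauC L Δ f e k := by ring
  rw [e1]
  have hτ : ‖tauC L Δ f e k‖ ≤ tauBar L Δ lam2 f := by
    refine (OuterMaj.tauTailBoundC_holds L Δ f e k).trans (le_of_eq ?_)
    rw [gradSNormClosed_holds L (by omega) Δ lam2 f hf e he]
    unfold tauBar sNormSq aPar
    ring
  rw [norm_mul]
  have : ‖(1 / 2 : ℂ)‖ = 1 / 2 := by
    rw [show (1 / 2 : ℂ) = ((1 / 2 : ℝ) : ℂ) by push_cast; ring, Complex.norm_real]
    norm_num
  rw [this]
  linarith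

/-- `φ̂_e(0) = γ` (ground profile, `e` a nearest neighbour). [folklore] -/
theorem phiHat_zero_eq (hL : 5 ≤ L) {Δ lam2 : ℝ} (hΔ0 : 0 ≤ Δ) {f : Tor L → ℝ} (hf : IsGroundTwoMagnon L Δ lam2 f)
    (hlam : 0 < lam2) {e : Tor L} (he : e ∈ nnList L) :
    phiHat L f e 0 = ((gamPar L Δ lam2 f : ℝ) : ℂ) :=
  (OuterMaj.phiHatClosedPlusTail_holds L hL hΔ0 lam2 f hf hlam e he).1

/-- the real part of the centre: `Re m = (1 − cos)(t/2 − β) + (q/2)(1 + cos)`, `cos = Re e^{ik·e}`. [folklore] -/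
theorem mC_re (Δ lam2 : ℝ) (f : Tor L → ℝ) (e k : Tor L) :
    (mC L Δ lam2 f e k).re
      = (1 - (phase L k e).re) * (tfun L Δ f k / 2 - betaK L Δ lam2 f k)
        + qPar L Δ f / 2 * (1 + (phase L k e).re) := by
  unfold mC muK zPh
  simp only [Complex.add_re, Complex.mul_re, Complex.sub_re, Complex.neg_re, Complex.one_re, Complex.conj_re,
    Complex.conj_im, Complex.ofReal_re, Complex.ofReal_im, Complex.sub_im, Complex.neg_im, Complex.one_im,
    Complex.add_im, Complex.mul_im, Complex.div_ofNat_re, Complex.div_ofNat_im]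
  ring

/-- the imaginary part of the centre: `Im m = sin·(t/2 − β − q/2)`, `sin = Im e^{ik·e}`. [folklore] -/
theorem mC_im (Δ lam2 : ℝ) (f : Tor L → ℝ) (e k : Tor L) :
    (mC L Δ lam2 f e k).im
      = (phase L k e).im * (tfun L Δ f k / 2 - betaK L Δ lam2 f k - qPar L Δ f / 2) := by
  unfold mC muK zPh
  simp only [Complex.add_re, Complex.mul_re, Complex.sub_re, Complex.neg_re, Complex.one_re, Complex.conj_re,
    Complex.conj_im, Complex.ofReal_re, Complex.ofReal_im, Complex.sub_im, Complex.neg_im, Complex.one_im,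
    Complex.add_im, Complex.mul_im, Complex.div_ofNat_re, Complex.div_ofNat_im]
  ring

/-! ## Moduli from a disc -/

omit [NeZero L] in
/-- `‖x − m‖ ≤ r ⇒ max(‖m‖ − r, 0)² ≤ |x|² ≤ (‖m‖ + r)²`. [folklore] -/
theorem normSq_bracket {x m : ℂ} {r : ℝ} (h : ‖x - m‖ ≤ r) :
    max (‖m‖ - r) 0 ^ 2 ≤ Complex.normSq x ∧ Complex.normSq x ≤ (‖m‖ + r) ^ 2 := by
  have hr : 0 ≤ r := (norm_nonneg _).trans h
  rw [Complex.normSq_eq_norm_sq]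
  have h1 : ‖x‖ ≤ ‖m‖ + r := by
    calc ‖x‖ = ‖m + (x - m)‖ := by rw [add_sub_cancel]
      _ ≤ ‖m‖ + ‖x - m‖ := norm_add_le _ _
      _ ≤ ‖m‖ + r := by linarith
  have h2 : ‖m‖ - r ≤ ‖x‖ := by
    have : ‖m‖ ≤ ‖x‖ + ‖m - x‖ := by
      calc ‖m‖ = ‖x + (m - x)‖ := by rw [add_sub_cancel]
        _ ≤ ‖x‖ + ‖m - x‖ := norm_add_le _ _
    rw [norm_sub_rev] at this
    linarith
  constructor
  · have hx : 0 ≤ ‖x‖ := norm_nonneg _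
    have hm : max (‖m‖ - r) 0 ≤ ‖x‖ := max_le h2 hx
    exact pow_le_pow_left₀ (le_max_right _ _) hm 2
  · exact pow_le_pow_left₀ (norm_nonneg _) h1 2

end FinXB

end Summit.HubbardSuperconductivity.HubbardSuperconductivity.Theorems.AnisotropyChord.Transfer.Fibre3

end
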